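import Summits.BirchSwinnertonDyer.BirchSwinnertonDyer.Theorems.SemiOrdinaryEisensteinDescentCasselsTateConjInvariance
import Summits.BirchSwinnertonDyer.BirchSwinnertonDyer.Theorems.SchneiderFreeAdditiveX3PoitouTateReciprocitySumHolds
import HarnessLib

/-!
# The levelwise Cassels–Tate fact for THE invariant maps ⟸ Milne I 4.10(a) in cochain form ALONE — the Poitou–Tate input
# AT `E[p^{M₀}]` DISCHARGED by the canonical family's `SelmerComplement` (Howard 2004 Thm. 2.1.11 for THE maps, every level)

Route `SemiOrdinaryEisensteinDescent` (BSD, rung W-ALL row 2·3@3), Kolyvagin column: print item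
`CasselsTateLevelInputsFact` (stmt-BirchSwinnertonDyer-20191 = `∀ K, casselsTate_levelInputs K`, conjunct 1 of
`KolyvaginPrimitivesAtThree` stmt-25896 = the `closes` binder `hPr`; also the `hCT`/`hCT3` binders of KolyvaginRoadThree,
ClassRecordThree, ErratumRoadFive). Width seat `bsd-wall-soed-p2-w3` g6; `--supports stmt-BirchSwinnertonDyer-20480`, helper.
Route-free (no `Theses` import), like its parents.

THEOREMS ONLY. Nothing here proves a case of BSD; no case of Poitou–Tate duality is proved IN THIS FILE (it is CONSUMED by name).

After w2 g2 (`casselsTate_levelInputs_of_canonical_inputs`: CT(K) ⟸ {hH3, hPTc, h615, hconj}), w3 g4 (hH3 a theorem, h615 ⟸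
Poitou–Tate AT `E[p^{M₀}]`; p618093/p618685/p619177) and w3 g5 (hconj a theorem; p624510), the levelwise Cassels–Tate fact for THE
maps read **CT(K) ⟸ hPTc + Howard (i) AT `E[p^{M₀}]`** (`casselsTate_levelInputs_of_hPTc_of_selmerComplementAt`). The second input is
the first conjunct of Howard's complement property `LocalInvariants.SelmerComplement` of THE canonical family
`LocalInvariants.canonical K (p^{M₀})` SPECIALISED to the module `(W/K)[p^{M₀}]` (`selmerComplementAtFst_torsion_of_selmerComplement`,
the ∀-module → AT-module adapter; `p^{M₀} · E[p^{M₀}] = 0` by `mem_geomTorsion_iff`). Hence: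

* `casselsTate_levelInputs_of_hPTc_of_selmerComplementCanonical` — **CT(K) ⟸ hPTc + `∀ n, (LocalInvariants.canonical K n).SelmerComplement`**
  (the ∀-level complement property of THE maps at the ONE field `K`; conditional, both binders displayed).

* `casselsTate_levelInputs_of_shaTwoCochain` — **CT(K) ⟸ hPTc ALONE**: the second binder discharged by cell bsd-schneider's Route A
  (door-c4/c5/c6 g17–g18: `…SchneiderFreeAdditiveX3.PoitouTateReduction.poitouTate_selmerStructure_duality_holds`, p624636, and
  `selmerComplement_canonical_holds`, p626891 — Howard's complement property of THE canonical family at every `K`, `n`).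

So **what separates `CasselsTateLevelInputsFact` (stmt-20191) from a theorem for THE maps is `hPTc` ALONE** — Milne I 4.10(a) for
`Ш²(K, E[q])` in the `PTChoice` cochain form (the H²-segment of Poitou–Tate; cells bsd-line-chl-p2 / bsd-schneider door-c5 degree-2 road).

## References

* [MilneADT2006] J. S. Milne, *Arithmetic Duality Theorems*, 2nd ed. (2006), Ch. I §6, Prop. 6.9, Thm. 6.13; Thm. 4.10 (a)(b).
* [Howard2004HeegnerKolyvagin] B. Howard, Compositio Math. 140 (2004), Thm. 2.1.11 (arXiv:1202.6340 p. 6).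
* [GrossLMS1991] B. H. Gross, *Kolyvagin's work on modular elliptic curves* (1991), §5 (5.1).
* [McCallumLMS1991] W. G. McCallum, *Kolyvagin's work on Shafarevich–Tate groups* (1991), §5, Thms. 5.4, 5.8.
-/

noncomputable section

open scoped Classical

set_option linter.dupNamespace false
set_option autoImplicit false

namespace Summit.BirchSwinnertonDyer.BirchSwinnertonDyer.Theorems.CasselsTateConj

open CategoryTheory _root_.WeierstrassCurve Field Function NumberField IsDedekindDomain
open Literature.NumberTheory.EllipticCurves Literature.NumberTheory.Automorphic
open Literature.NumberTheory.GaloisRepresentations Literature.NumberTheory.GaloisCohomology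
open Literature.NumberTheory.GaloisRepresentations.DiscreteGaloisModule (mu MuCarrier pairing SelmerStructure
  unramifiedSubgroup localTatePairingZMod tateDual)
open Summit.BirchSwinnertonDyer.BirchSwinnertonDyer.Theorems.CasselsTateLemma615OfPT
open Summit.BirchSwinnertonDyer.BirchSwinnertonDyer.Theorems.SchneiderFreeAdditiveX3.PoitouTateReduction (selmerComplement_canonical_holds)

/-! ## The ∀-module → AT-module adapter -/

/-- **Howard (i) AT `(W/K)[p^{M₀}]` for THE maps from the ∀-module complement property of `LocalInvariants.canonical K (p^{M₀})`**:
the first conjunct of `LocalInvariants.SelmerComplement` specialised to the discrete `Γ_K`-module `E[p^{M₀}](K̄)`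
(`p^{M₀}`-torsion by `mem_geomTorsion_iff`), in the exact binder shape of
`casselsTate_levelInputs_of_hPTc_of_selmerComplementAt` (any `Finite` instance on the torsion points will do).
[cite: Howard2004HeegnerKolyvagin, Thm. 2.1.11 (arXiv:1202.6340 p. 6)] [cite: MilneADT2006, Ch. I, Thm. 4.10(b)] -/
theorem selmerComplementAtFst_torsion_of_selmerComplement (K : Type) [Field K] [NumberField K]
    (W : WeierstrassCurve ℚ) [W.IsElliptic] (p M₀ : ℕ) [NeZero (p ^ M₀)]
    [Finite ((W.baseChange K).geomTorsion ((p ^ M₀ : ℕ) : ℤ))]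
    (hSC : (LocalInvariants.canonical K (p ^ M₀)).SelmerComplement) (S : Finset (Place K))
    (hS : ∀ v : HeightOneSpectrum (𝓞 K), (Sum.inr v : Place K) ∉ S →
        ((p ^ M₀ : ℕ) : 𝓞 K) ∉ v.asIdeal ∧
          GaloisRep.IsUnramifiedAt v ((W.baseChange K).torsionGaloisModule ((p ^ M₀ : ℕ) : ℤ)))
    (𝓕 𝓖 : SelmerStructure ((W.baseChange K).torsionGaloisModule ((p ^ M₀ : ℕ) : ℤ))) (hle : 𝓕 ≤ 𝓖)
    (h𝓕 : 𝓕.IsUnramifiedOutside S) (h𝓖 : 𝓖.IsUnramifiedOutside S)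
    (t : Π v : Place K, galoisCohomology (((W.baseChange K).torsionGaloisModule ((p ^ M₀ : ℕ) : ℤ)).toLocal v) 1)
    (ht : ∀ v ∈ S, t v ∈ 𝓖 v)
    (horth : ∀ y ∈ ((LocalInvariants.canonical K (p ^ M₀)).dualSelmerStructure
        ((W.baseChange K).torsionGaloisModule ((p ^ M₀ : ℕ) : ℤ)) 𝓕).selmerGroup,
      ∑ v ∈ S, localTatePairingZMod ((W.baseChange K).torsionGaloisModule ((p ^ M₀ : ℕ) : ℤ)) (p ^ M₀) v
        (LocalInvariants.canonical K (p ^ M₀) v) (t v)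
        (galoisCohomology.localization
          (((W.baseChange K).torsionGaloisModule ((p ^ M₀ : ℕ) : ℤ)).tateDual (p ^ M₀)) v 1 y) = 0) :
    ∃ x ∈ 𝓖.selmerGroup, ∀ v ∈ S,
      galoisCohomology.localization ((W.baseChange K).torsionGaloisModule ((p ^ M₀ : ℕ) : ℤ)) v 1 x - t v ∈ 𝓕 v :=
  (hSC ((W.baseChange K).torsionGaloisModule ((p ^ M₀ : ℕ) : ℤ))
    (fun P => Subtype.ext (by
      have h := (mem_geomTorsion_iff (W.baseChange K) ((p ^ M₀ : ℕ) : ℤ) (P : geomPoints (W.baseChange K))).mp P.2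
      rw [natCast_zsmul] at h
      exact h))
    S hS 𝓕 𝓖 hle h𝓕 h𝓖).1 t ht horth

/-! ## The levelwise Cassels–Tate fact from `hPTc` and the ∀-level complement property of THE maps at `K` -/

/-- **`casselsTate_levelInputs K` ⟸ Milne I 4.10(a) in cochain form (`hPTc`) + Howard's complement property of THE canonical family
`LocalInvariants.canonical K n` at every level `n`** (`hSC`, Howard 2004 Thm. 2.1.11 / Milne I 4.10(b) `⊇` for THE maps — the
conclusion shape of cell bsd-schneider's Route A at the field `K`). = w3 g5's `casselsTate_levelInputs_of_hPTc_of_selmerComplementAt`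
with its per-module Poitou–Tate binder fed by `selmerComplementAtFst_torsion_of_selmerComplement` at `n = p^{M₀}`. Conditional on
both displayed binders; conjuncts (i) reciprocity, (ii) local duality, (iii) `Ш³ = 0`, Lemma 6.15, (v) `Aut(K/ℚ)`-invariance of the
named fact are theorems for THE maps (w2 g2, w3 g4, w3 g5).
[cite: MilneADT2006, Ch. I, Thm. 4.10(a)(b), §6 Prop. 6.9, Thm. 6.13] [cite: Howard2004HeegnerKolyvagin, Thm. 2.1.11 (arXiv:1202.6340 p. 6)]
[cite: GrossLMS1991, §5 (5.1)] [cite: McCallumLMS1991, §5, Thm. 5.4, Thm. 5.8] -/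
theorem casselsTate_levelInputs_of_hPTc_of_selmerComplementCanonical (K : Type) [Field K] [NumberField K]
    (hPTc : ∀ (W : WeierstrassCurve ℚ) [W.IsElliptic] (p M₀ : ℕ), p.Prime → p ≠ 2 → 1 ≤ M₀ →
      ∀ [NeZero (p ^ M₀)]
        (e : geomTorsion (W.baseChange K) ((p ^ M₀ * p ^ M₀ : ℕ) : ℤ) →
          geomTorsion (W.baseChange K) ((p ^ M₀ * p ^ M₀ : ℕ) : ℤ) → AlgebraicClosure K)
        (hμ : ∀ S T, e S T ^ (p ^ M₀ * p ^ M₀) = 1)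
        (hadd₁ : ∀ S₁ S₂ T, e (S₁ + S₂) T = e S₁ T * e S₂ T)
        (hadd₂ : ∀ S T₁ T₂, e S (T₁ + T₂) = e S T₁ * e S T₂)
        (hgal : ∀ (σ : absoluteGaloisGroup K)
          (S T : geomTorsion (W.baseChange K) ((p ^ M₀ * p ^ M₀ : ℕ) : ℤ)), σ • e S T = e (σ • S) (σ • T)),
        (∀ T, e T T = 1) → (∀ T, (∀ S, e S T = 1) → T = 0) →
        ∀ f : contTwoCocycles ((W.baseChange K).torsionGaloisModule ((p ^ M₀ : ℕ) : ℤ)).toTopRep,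
          (∀ g : contOneCocycles ((W.baseChange K).torsionGaloisModule ((p ^ M₀ : ℕ) : ℤ)).toTopRep,
            (∀ v : Place K, locClass ((W.baseChange K).torsionGaloisModule ((p ^ M₀ : ℕ) : ℤ))
                (Place.Completion v)
                (resOne ((W.baseChange K).torsionGaloisModule ((p ^ M₀ : ℕ) : ℤ)) (Place.Completion v) g) = 0) →
            ∃ (C : PTChoice (W.baseChange K) (p ^ M₀) e hμ hadd₁ hadd₂ hgal f g) (S : Finset (Place K)),
              (∀ v ∉ S, C.localTerm (LocalInvariants.canonical K (p ^ M₀ * p ^ M₀)) v = 0) ∧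
                ∑ v ∈ S, C.localTerm (LocalInvariants.canonical K (p ^ M₀ * p ^ M₀)) v = 0) →
          twoCocycleClass _ f = 0)
    (hSC : ∀ (n : ℕ) [NeZero n], (LocalInvariants.canonical K n).SelmerComplement) :
    casselsTate_levelInputs K :=
  casselsTate_levelInputs_of_hPTc_of_selmerComplementAt K hPTc
    (fun W _ p M₀ _ _ _ _ _ S hS 𝓕 𝓖 hle h𝓕 h𝓖 t ht horth =>
      selmerComplementAtFst_torsion_of_selmerComplement K W p M₀ (hSC (p ^ M₀)) S hS 𝓕 𝓖 hle h𝓕 h𝓖 t ht horth)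

/-! ## The levelwise Cassels–Tate fact from `hPTc` ALONE -/

/-- **`casselsTate_levelInputs K` ⟸ Milne I 4.10(a) in cochain form (`hPTc`) ALONE** — the per-module Poitou–Tate binder of w3 g5's
`casselsTate_levelInputs_of_hPTc_of_selmerComplementAt` DISCHARGED by Howard's complement property of THE canonical family at every
level (`SchneiderFreeAdditiveX3.PoitouTateReduction.selmerComplement_canonical_holds`, cell bsd-schneider Route A, Milne I 4.10 (b)
proof / Cassels–Fröhlich VII §11) through `selmerComplementAtFst_torsion_of_selmerComplement`. So for THE maps, conjuncts (i)
reciprocity, (ii) local duality, (iii) `Ш³ = 0`, (iv) Lemma 6.15 (⟸ Poitou–Tate at `E[p^{M₀}]`, now a theorem) and (v) `Aut(K/ℚ)`-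
invariance of the named fact `casselsTate_levelInputs K` are ALL theorems; **what separates `CasselsTateLevelInputsFact`
(stmt-BirchSwinnertonDyer-20191) from a theorem is `hPTc` — Milne I 4.10(a) for `Ш²(K, E[q])` in the `PTChoice` cochain form —
and nothing else.** CONDITIONAL on `hPTc`; no case of BSD; Poitou–Tate for Selmer structures is consumed by name, not proved here.
[cite: MilneADT2006, Ch. I, Thm. 4.10(a)(b), §6 Prop. 6.9, Thm. 6.13] [cite: Howard2004HeegnerKolyvagin, Thm. 2.1.11 (arXiv:1202.6340 p. 6)]
[cite: GrossLMS1991, §5 (5.1)] [cite: McCallumLMS1991, §5, Thm. 5.4, Thm. 5.8] [cite: CasselsFrohlichANT1967, Ch. VII §11] -/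
theorem casselsTate_levelInputs_of_shaTwoCochain (K : Type) [Field K] [NumberField K]
    (hPTc : ∀ (W : WeierstrassCurve ℚ) [W.IsElliptic] (p M₀ : ℕ), p.Prime → p ≠ 2 → 1 ≤ M₀ →
      ∀ [NeZero (p ^ M₀)]
        (e : geomTorsion (W.baseChange K) ((p ^ M₀ * p ^ M₀ : ℕ) : ℤ) →
          geomTorsion (W.baseChange K) ((p ^ M₀ * p ^ M₀ : ℕ) : ℤ) → AlgebraicClosure K)
        (hμ : ∀ S T, e S T ^ (p ^ M₀ * p ^ M₀) = 1)
        (hadd₁ : ∀ S₁ S₂ T, e (S₁ + S₂) T = e S₁ T * e S₂ T)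
        (hadd₂ : ∀ S T₁ T₂, e S (T₁ + T₂) = e S T₁ * e S T₂)
        (hgal : ∀ (σ : absoluteGaloisGroup K)
          (S T : geomTorsion (W.baseChange K) ((p ^ M₀ * p ^ M₀ : ℕ) : ℤ)), σ • e S T = e (σ • S) (σ • T)),
        (∀ T, e T T = 1) → (∀ T, (∀ S, e S T = 1) → T = 0) →
        ∀ f : contTwoCocycles ((W.baseChange K).torsionGaloisModule ((p ^ M₀ : ℕ) : ℤ)).toTopRep,
          (∀ g : contOneCocycles ((W.baseChange K).torsionGaloisModule ((p ^ M₀ : ℕ) : ℤ)).toTopRep,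
            (∀ v : Place K, locClass ((W.baseChange K).torsionGaloisModule ((p ^ M₀ : ℕ) : ℤ))
                (Place.Completion v)
                (resOne ((W.baseChange K).torsionGaloisModule ((p ^ M₀ : ℕ) : ℤ)) (Place.Completion v) g) = 0) →
            ∃ (C : PTChoice (W.baseChange K) (p ^ M₀) e hμ hadd₁ hadd₂ hgal f g) (S : Finset (Place K)),
              (∀ v ∉ S, C.localTerm (LocalInvariants.canonical K (p ^ M₀ * p ^ M₀)) v = 0) ∧
                ∑ v ∈ S, C.localTerm (LocalInvariants.canonical K (p ^ M₀ * p ^ M₀)) v = 0) →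
          twoCocycleClass _ f = 0) :
    casselsTate_levelInputs K :=
  casselsTate_levelInputs_of_hPTc_of_selmerComplementCanonical K hPTc fun n _ ↦ selmerComplement_canonical_holds K n

end Summit.BirchSwinnertonDyer.BirchSwinnertonDyer.Theorems.CasselsTateConj

end
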